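import Literature.Computability.Cryptography.RegevStageKernelLaws
import HarnessLib

/-!
# Regev 2009, Theorem 3.1 in machine form, IV: batch codes and the collecting post-processor

Topic `Computability/Cryptography` (family `pqc`), sequel of `RegevStageKernelLaws.lean` (pqc.S19, SIVP
form, from KERNEL-level laws of one stage family `S`). The stage family will be (sequel,
`RegevStageCopies.lean`) the classical wrap `S = CWrap(⟨·, ε⟩, PolyCopiesIdx(Q), post)` of `N(n) = p_N(n)`
indexed parallel copies of a ONE-SAMPLE stage machine `Q` (Regev 2009, proof of Theorem 3.1, p. 15:
"by applying [the iterative step] `n^c` times we obtain `n^c` samples"; the copies run on disjoint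
wires, `QuantumComplexity/PolyCopiesIdx*.lean`), each copy writing the self-delimited code of ONE
lattice vector at the front of its segment of the measured register. This file supplies the classical,
string-level parts of that machine:

* **batch codes** (`Regev2009.vecCode`, `Regev2009.encBatch n N b = encList [code v₀, …, code v_{N-1}]`,
  the concatenation of the framed vector codes): the first vector is read by the tree's `DGS` reader
  (`decodeLatticeVector_encBatch_append`), batch codes in front of a string are unique
  (`encBatch_eq_of_prefix`), their items are the fields `nthF j` (`nthF_encBatch_append`),
  their length is controlled by the lengths of the vector codes (`length_encBatch_le`); the total
  classical **batch reader** `Regev2009.readBatch` (`readBatch (encBatch b ++ w) = b`, junk batch `0`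
  when no batch code is in front) — the `readB` of `thm_3_1_stage_of_kernelLaws`;
* **the collecting post-processor** `Regev2009.StagePost.postG P pN mS ∈ FP` of the wrap, on the
  context `⟨z, Y⟩` (`z = ⟨x, ⟨1ᵏ, y⟩⟩` the stage input, `Y` the measured register of the copies family
  with layout `P`): the coded list of the first pair components of `Y` read from the first wires
  `base + j·b` of the copies `j < p_N(n)` (an `appF`-fold, as `LWE.AmpBricks.candsC`), followed by the
  padding `1^{mS(|x|)}` (so that the window handed to the next stage is a function of the collected
  codes alone); **`postG_mem_FP`** and its value **`postG_ctx`** (Arora–Barak 2009, §1.3: bounded loops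
  of polynomial-time string functions).

Everything is proved; no named fact is introduced.

## References

* O. Regev, *On lattices, learning with errors, random linear codes, and cryptography*, J. ACM 56
  (2009), art. 34; author's version arXiv:2401.03703, Theorem 3.1 (proof, p. 15) [Regev2009].
* S. Arora, B. Barak, *Computational Complexity: A Modern Approach*, CUP 2009, §0.1 (codes of tuples
  and lists), §1.3 (polynomial time; bounded loops) [AroraBarak2009].
-/

noncomputable section

namespace Literature.Computability.Cryptography

namespace Regev2009

open _root_.Computability Polynomial Literature.Computability.Complexity Brick Plumb HashBricks QuantumComplexity
  Literature.Algebra.EuclideanLattices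
open LWE.RegevBricks (loopRec loopRec_mem_FP loopRec_apply frames_ofFn_eq_ccat')

/-! ### Batch codes -/

section BatchCode

variable (n N : ℕ)

/-- The code of an integer vector of dimension `n` (`encodeIntVec ⟨n, v⟩`). [cite: AroraBarak2009, §0.1] -/
def vecCode (v : Fin n → ℤ) : List Bool := encodeIntVec ⟨n, v⟩

/-- **The code of a batch of `N` vectors**: the coded list of the vector codes, i.e. the concatenation
of the framed codes `⟨code v₀, ε⟩ ⟨code v₁, ε⟩ ⋯`. [cite: AroraBarak2009, §0.1 (codes of lists)] -/
def encBatch (b : Fin N → Fin n → ℤ) : List Bool := encList (List.ofFn fun j => vecCode n (b j))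

variable {n N}

/-- `vecCode` is injective. [folklore] -/
theorem vecCode_injective : Function.Injective (vecCode n) := fun v w h => by
  rw [← decodeIntVec_encodeIntVec n v, ← decodeIntVec_encodeIntVec n w]
  exact congrArg (decodeIntVec n) h

/-- A coded cons followed by anything. [folklore] -/
theorem encList_cons_append (c : List Bool) (l : List (List Bool)) (s : List Bool) :
    encList (c :: l) ++ s = boolPair c (encList l ++ s) := by
  rw [encList_cons, boolPair_append]

/-- **Coded lists of equal lengths in front of the same string are equal.** [folklore] -/
theorem encList_eq_of_prefix : ∀ {l l' : List (List Bool)} {z : List Bool},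
    l.length = l'.length → encList l <+: z → encList l' <+: z → l = l'
  | [], [], _, _, _, _ => rfl
  | [], _ :: _, _, h, _, _ => by simp at h
  | _ :: _, [], _, h, _, _ => by simp at h
  | c :: l, c' :: l', z, h, ⟨s, hs⟩, ⟨s', hs'⟩ => by
    rw [encList_cons_append] at hs hs'
    have e := congrArg boolUnpair (hs.trans hs'.symm)
    rw [boolUnpair_boolPair, boolUnpair_boolPair, Prod.mk.injEq] at e
    obtain ⟨rfl, e2⟩ := e
    rw [encList_eq_of_prefix (l := l) (l' := l') (z := encList l ++ s) (by simpa using h) ⟨s, rfl⟩ ⟨s', e2.symm⟩]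

/-- **Batch codes in front of a string are unique** (the prefix-uniqueness clause of
`thm_3_1_stage_of_kernelLaws`). [folklore] -/
theorem encBatch_eq_of_prefix {b b' : Fin N → Fin n → ℤ} {z : List Bool} (h : encBatch n N b <+: z)
    (h' : encBatch n N b' <+: z) : b = b' := by
  have e := encList_eq_of_prefix (by simp) h h'
  rw [List.ofFn_inj] at e
  exact funext fun j => vecCode_injective (congrFun e j)

/-- **The `DGS` reader reads the first vector of a batch code** (the decoding clause of
`thm_3_1_stage_of_kernelLaws`). [folklore] -/
theorem decodeLatticeVector_encBatch_append (hN : 0 < N) (b : Fin N → Fin n → ℤ) (w : List Bool) :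
    decodeLatticeVector n (encBatch n N b ++ w) = b ⟨0, hN⟩ := by
  obtain ⟨N', rfl⟩ : ∃ N', N = N' + 1 := ⟨N - 1, by omega⟩
  rw [encBatch, List.ofFn_succ, encList_cons_append, vecCode, decodeLatticeVector_boolPair]
  rfl

/-- **Item `j` of a coded list in front of a string** is its field `j` (`nthF j`). [folklore] -/
theorem nthF_encList_append : ∀ (j : ℕ) (l : List (List Bool)) (s : List Bool) (hj : j < l.length),
    nthF j (encList l ++ s) = l[j]
  | _, [], _, hj => by simp at hj
  | 0, c :: l, s, _ => by rw [encList_cons_append, nthF_zero_boolPair, List.getElem_cons_zero]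
  | j + 1, c :: l, s, hj => by
    rw [encList_cons_append, nthF_succ_boolPair, nthF_encList_append j l s (by simpa using hj), List.getElem_cons_succ]

/-- **Item `j` of a batch code in front of a string.** [folklore] -/
theorem nthF_encBatch_append (b : Fin N → Fin n → ℤ) (w : List Bool) (j : Fin N) :
    nthF j (encBatch n N b ++ w) = vecCode n (b j) := by
  rw [encBatch, nthF_encList_append _ _ _ (by simp), List.getElem_ofFn]

/-- The length of a coded list with items of length `≤ Lb`. [folklore] -/
theorem length_encList_le {Lb : ℕ} : ∀ (l : List (List Bool)), (∀ c ∈ l, c.length ≤ Lb) →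
    (encList l).length ≤ l.length * (2 * Lb + 2)
  | [], _ => by simp
  | c :: l, h => by
    rw [encList_cons, length_boolPair, List.length_cons, Nat.add_mul, one_mul]
    have hc := h c (by simp)
    have hl := length_encList_le l fun c' hc' => h c' (by simp [hc'])
    omega

/-- **The length of a batch code with vector codes of length `≤ Lb`** is at most `N (2 Lb + 2)`.
[folklore] -/
theorem length_encBatch_le {Lb : ℕ} (b : Fin N → Fin n → ℤ) (hb : ∀ j, (vecCode n (b j)).length ≤ Lb) :
    (encBatch n N b).length ≤ N * (2 * Lb + 2) := by
  have h := length_encList_le (Lb := Lb) (List.ofFn fun j => vecCode n (b j)) fun c hc => by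
    rw [List.mem_ofFn] at hc
    obtain ⟨j, rfl⟩ := hc
    exact hb j
  rwa [List.length_ofFn] at h

variable (n N)

/-- **The total batch reader**: the batch whose code is in front of `y`, the junk batch `0` if there is
none (a specification-level function; a machine parses the `N` frames and re-checks the prefix).
[cite: AroraBarak2009, §0.1] -/
def readBatch (y : List Bool) : Fin N → Fin n → ℤ := (readFront (encBatch n N) y).getD 0

variable {n N}

/-- **The reader reads batch codes placed in front.** [folklore] -/
theorem readBatch_append (b : Fin N → Fin n → ℤ) (w : List Bool) : readBatch n N (encBatch n N b ++ w) = b := by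
  rw [readBatch, readFront_append _ fun _ _ _ h h' => encBatch_eq_of_prefix h h']
  rfl

/-- **The reader returns the junk batch when no batch code is in front.** [folklore] -/
theorem readBatch_of_not_exists {y : List Bool} (h : ¬ ∃ b, encBatch n N b <+: y) : readBatch n N y = 0 := by
  classical
  unfold readBatch readFront
  rw [dif_neg h]
  rfl

/-- The reader on a string with a batch code in front. [folklore] -/
theorem readBatch_of_prefix {b : Fin N → Fin n → ℤ} {y : List Bool} (h : encBatch n N b <+: y) : readBatch n N y = b := by
  obtain ⟨w, rfl⟩ := h
  exact readBatch_append b w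

end BatchCode

/-! ### The collecting post-processor -/

namespace StagePost

section Defs

variable (P : PolyCopies.Params) (pN mS : Polynomial ℕ)

/-- `1^{|u|}`, `u = ⟨z, ε⟩` the input of the copies family, `|u| = 2|z| + 2`. [folklore] -/
def uUC : List Bool → List Bool := polyFn (2 * X + 2) ∘ fstF
/-- **`bin b`**, `b` the block width of the copies at input length `|u|`. [folklore] -/
def bBC : List Bool → List Bool := lenBinF ∘ polyFn (PolyCopiesIdx.bPoly P) ∘ uUC
/-- **`bin base`**, `base` the first block wire. [folklore] -/
def bBaseC : List Bool → List Bool := lenBinF ∘ polyFn (PolyCopiesIdx.basePoly P) ∘ uUC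
/-- `bin (base + j b)`: the first wire of copy `j` (piece context `⟨ctx, 1ʲ⟩`). [folklore] -/
def bOffP : List Bool → List Bool :=
  addFn ∘ fanoutFn (bBaseC P ∘ fstF) (prodFn ∘ fanoutFn (lenBinF ∘ sndF) (bBC P ∘ fstF))
/-- `1^{offset}` capped by `|Y|`. [folklore] -/
def uOffP : List Bool → List Bool := binToUnaryFn ∘ fanoutFn (sndF ∘ fstF) (bOffP P)
/-- `Y ⇂ offset`. [folklore] -/
def dropP : List Bool → List Bool := dropFn ∘ fanoutFn (uOffP P) (sndF ∘ fstF)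
/-- **The item of copy `j`**, framed: `⟨fstF (Y ⇂ offset), ε⟩` — the self-delimited code the copy wrote
at the front of its segment. [folklore] -/
def pieceP : List Bool → List Bool := fanoutFn (fstF ∘ dropP P) fun _ => []
/-- The instance code `x` (`ctx = ⟨⟨x, ⟨1ᵏ, y⟩⟩, Y⟩`). [folklore] -/
def xC : List Bool → List Bool := fstF ∘ fstF
/-- `bin n`, read off `x = ⟨⟨bin n, B⟩, r⟩`. [folklore] -/
def bnC : List Bool → List Bool := fstF ∘ fstF ∘ xC
/-- `1ⁿ` (binary-to-unary conversion capped by `|x| ≥ n`). [folklore] -/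
def unC : List Bool → List Bool := binToUnaryFn ∘ fanoutFn xC bnC
/-- **`bin N`**, `N = p_N(n)` the number of collected copies. [folklore] -/
def bNC : List Bool → List Bool := lenBinF ∘ polyFn pN ∘ unC
/-- **The coded list of the `N` items**: an `appF`-fold over `j < N` (budget `p_N(|ctx|) ≥ N`).
[cite: AroraBarak2009, §1.3 (bounded loops)] -/
def foldC : List Bool → List Bool := sndPow 2 ∘ foldLoop appF (clipF 2 (pieceP P)) pN ∘ loopRec (bNC pN)
/-- The padding `1^{mS(|x|)}`. [folklore] -/
def padC : List Bool → List Bool := polyFn mS ∘ xC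
/-- **The collecting post-processor**: the coded list of the `N` items, then the padding.
[cite: Regev2009, Theorem 3.1 (proof, p. 15: "we obtain n^c samples")] -/
def postG : List Bool → List Bool := appF ∘ fanoutFn (foldC P pN) (padC mS)

end Defs

/-! ### Polynomial time -/

section FP

variable (P : PolyCopies.Params) (pN mS : Polynomial ℕ)

/-- `uUC ∈ FP`. [folklore] -/
theorem uUC_mem_FP : uUC ∈ FP := comp_mem_FP (polyFn_mem_FP _) fstF_mem_FP
/-- `bBC ∈ FP`. [folklore] -/
theorem bBC_mem_FP : bBC P ∈ FP := comp_mem_FP lenBinF_mem_FP (comp_mem_FP (polyFn_mem_FP _) uUC_mem_FP)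
/-- `bBaseC ∈ FP`. [folklore] -/
theorem bBaseC_mem_FP : bBaseC P ∈ FP := comp_mem_FP lenBinF_mem_FP (comp_mem_FP (polyFn_mem_FP _) uUC_mem_FP)
/-- `bOffP ∈ FP`. [folklore] -/
theorem bOffP_mem_FP : bOffP P ∈ FP :=
  comp_mem_FP addFn_mem_FP (fanoutFn_mem_FP (comp_mem_FP (bBaseC_mem_FP P) fstF_mem_FP)
    (comp_mem_FP prodFn_mem_FP (fanoutFn_mem_FP (comp_mem_FP lenBinF_mem_FP sndF_mem_FP) (comp_mem_FP (bBC_mem_FP P) fstF_mem_FP))))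
/-- `uOffP ∈ FP`. [folklore] -/
theorem uOffP_mem_FP : uOffP P ∈ FP :=
  comp_mem_FP binToUnaryFn_mem_FP (fanoutFn_mem_FP (comp_mem_FP sndF_mem_FP fstF_mem_FP) (bOffP_mem_FP P))
/-- `dropP ∈ FP`. [folklore] -/
theorem dropP_mem_FP : dropP P ∈ FP :=
  comp_mem_FP dropFn_mem_FP (fanoutFn_mem_FP (uOffP_mem_FP P) (comp_mem_FP sndF_mem_FP fstF_mem_FP))
/-- `pieceP ∈ FP`. [folklore] -/
theorem pieceP_mem_FP : pieceP P ∈ FP := fanoutFn_mem_FP (comp_mem_FP fstF_mem_FP (dropP_mem_FP P)) (const_mem_FP _)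
/-- `xC ∈ FP`. [folklore] -/
theorem xC_mem_FP : xC ∈ FP := comp_mem_FP fstF_mem_FP fstF_mem_FP
/-- `bnC ∈ FP`. [folklore] -/
theorem bnC_mem_FP : bnC ∈ FP := comp_mem_FP fstF_mem_FP (comp_mem_FP fstF_mem_FP xC_mem_FP)
/-- `unC ∈ FP`. [folklore] -/
theorem unC_mem_FP : unC ∈ FP := comp_mem_FP binToUnaryFn_mem_FP (fanoutFn_mem_FP xC_mem_FP bnC_mem_FP)
/-- `bNC ∈ FP`. [folklore] -/
theorem bNC_mem_FP : bNC pN ∈ FP := comp_mem_FP lenBinF_mem_FP (comp_mem_FP (polyFn_mem_FP _) unC_mem_FP)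
/-- `foldC ∈ FP`. [cite: AroraBarak2009, §1.3 (bounded loops)] -/
theorem foldC_mem_FP : foldC P pN ∈ FP :=
  comp_mem_FP (sndPow_mem_FP 2) (comp_mem_FP (foldLoop_clipF_mem_FP 2 appF_mem_FP length_appF_le (pieceP_mem_FP P) pN)
    (loopRec_mem_FP (bNC_mem_FP pN)))
/-- `padC ∈ FP`. [folklore] -/
theorem padC_mem_FP : padC mS ∈ FP := comp_mem_FP (polyFn_mem_FP _) xC_mem_FP
/-- **`postG ∈ FP`.** [cite: AroraBarak2009, §1.3] -/
theorem postG_mem_FP : postG P pN mS ∈ FP := comp_mem_FP appF_mem_FP (fanoutFn_mem_FP (foldC_mem_FP P pN) (padC_mem_FP mS))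

end FP

/-! ### Values -/

section Values

variable (P : PolyCopies.Params) (pN mS : Polynomial ℕ) (I : LatticeInstance) (r : ℚ) (k : ℕ) (y Y : List Bool)

/-- The stage input `z = ⟨x, ⟨1ᵏ, y⟩⟩`. [folklore] -/
def zOf : List Bool := stageInput (GapSVPInstance.encode (I, r)) k y
/-- The input length `|u| = 2|z| + 2` of the copies family (`u = ⟨z, ε⟩`). [folklore] -/
def mOf : ℕ := 2 * (zOf I r k y).length + 2
/-- **The first wire of copy `j`**: `base + j b` at input length `|u|`. [folklore] -/
def offOf (j : ℕ) : ℕ := PolyCopiesIdx.base P (mOf I r k y) + j * PolyCopiesIdx.b P (mOf I r k y)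
/-- **The item of copy `j`**: the first pair component of `Y` from the copy's first wire on. [folklore] -/
def itemOf (j : ℕ) : List Bool := fstF (Y.drop (offOf P I r k y j))
/-- The context `⟨z, Y⟩` of the post-processor. [folklore] -/
def ctxOf : List Bool := boolPair (zOf I r k y) Y

/-- The instance code is the pair of the lattice code and the threshold code. [folklore] -/
theorem fstF_encode : fstF (GapSVPInstance.encode (I, r)) = I.encode := fstF_boolPair _ _

/-- The lattice code starts with the dimension. [folklore] -/
theorem fstF_latticeEncode : fstF I.encode = encodeNat I.n := by
  rw [LatticeInstance.encode_eq]
  exact fstF_boolPair (encodeNat I.n) _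

/-- `n ≤ |x|`. [folklore] -/
theorem n_le_length_encode : I.n ≤ (GapSVPInstance.encode (I, r)).length := by
  have h := I.n_le_length_encode
  have : (GapSVPInstance.encode (I, r)).length = 2 * I.encode.length + 2 + (encodeRat r).length := length_boolPair _ _
  omega

/-- Value of `xC`: the instance code. [folklore] -/
@[simp] theorem xC_ctx : xC (ctxOf I r k y Y) = GapSVPInstance.encode (I, r) := by
  simp [xC, ctxOf, zOf, stageInput]

/-- Value of `bnC`: `bin n`. [folklore] -/
@[simp] theorem bnC_ctx : bnC (ctxOf I r k y Y) = encodeNat I.n := by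
  rw [bnC, Function.comp_apply, Function.comp_apply, xC_ctx, fstF_encode, fstF_latticeEncode]

/-- Value of `unC`: `1ⁿ`. [folklore] -/
@[simp] theorem unC_ctx : unC (ctxOf I r k y Y) = ones I.n := by
  rw [unC, Function.comp_apply, fanoutFn_apply, bnC_ctx, xC_ctx, binToUnaryFn_boolPair, bitsToNat_encodeNat,
    min_eq_left (n_le_length_encode I r)]

/-- Value of `bNC`: `bin N`. [folklore] -/
@[simp] theorem bNC_ctx : bNC pN (ctxOf I r k y Y) = encodeNat (pN.eval I.n) := by
  rw [bNC, Function.comp_apply, Function.comp_apply, unC_ctx, polyFn_apply, lenBinF_apply]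
  simp [ones]

/-- Value of `uUC`: `1^{|u|}`. [folklore] -/
@[simp] theorem uUC_ctx : uUC (ctxOf I r k y Y) = ones (mOf I r k y) := by
  simp [uUC, ctxOf, mOf]

/-- Value of `bBC`: `bin b`. [folklore] -/
@[simp] theorem bBC_ctx : bBC P (ctxOf I r k y Y) = encodeNat (PolyCopiesIdx.b P (mOf I r k y)) := by
  rw [bBC, Function.comp_apply, Function.comp_apply, uUC_ctx, polyFn_apply, lenBinF_apply]
  simp [ones]

/-- Value of `bBaseC`: `bin base`. [folklore] -/
@[simp] theorem bBaseC_ctx : bBaseC P (ctxOf I r k y Y) = encodeNat (PolyCopiesIdx.base P (mOf I r k y)) := by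
  rw [bBaseC, Function.comp_apply, Function.comp_apply, uUC_ctx, polyFn_apply, lenBinF_apply]
  simp [ones]

variable (j : ℕ)

/-- The piece context of copy `j`. [folklore] -/
def pcOf : List Bool := boolPair (ctxOf I r k y Y) (ones j)

/-- Value of `bOffP`: `bin (base + j b)`. [folklore] -/
@[simp] theorem bOffP_pc : bOffP P (pcOf I r k y Y j) = encodeNat (offOf P I r k y j) := by
  simp [bOffP, pcOf, ones, offOf]

/-- Value of `dropP`: `Y ⇂ offset` (also when the offset exceeds `|Y|`). [folklore] -/
theorem dropP_pc : dropP P (pcOf I r k y Y j) = Y.drop (offOf P I r k y j) := by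
  rw [dropP, Function.comp_apply, fanoutFn_apply, uOffP, Function.comp_apply, fanoutFn_apply, bOffP_pc]
  simp only [Function.comp_apply, pcOf, fstF_boolPair, ctxOf, sndF_boolPair, binToUnaryFn_boolPair, bitsToNat_encodeNat,
    dropFn_boolPair, ones, List.length_replicate]
  by_cases h : offOf P I r k y j ≤ Y.length
  · rw [min_eq_left h]
  · rw [min_eq_right (not_le.1 h).le, List.drop_length, List.drop_eq_nil_of_le (not_le.1 h).le]

/-- **Value of `pieceP`**: the framed item of copy `j`. [folklore] -/
theorem pieceP_pc : pieceP P (boolPair (ctxOf I r k y Y) (ones j)) = boolPair (itemOf P I r k y Y j) [] := by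
  rw [pieceP, fanoutFn_apply, Function.comp_apply, ← show pcOf I r k y Y j = boolPair (ctxOf I r k y Y) (ones j) from rfl,
    dropP_pc, itemOf]

variable {j}

/-- An item is short: `|itemOf j| ≤ |Y|`. [folklore] -/
theorem length_itemOf_le (j : ℕ) : (itemOf P I r k y Y j).length ≤ Y.length := by
  rw [itemOf]
  have h1 := length_fstF_sndF_le (Y.drop (offOf P I r k y j))
  have h2 : (Y.drop (offOf P I r k y j)).length ≤ Y.length := by rw [List.length_drop]; omega
  omega

/-- `n ≤ |ctx|`. [folklore] -/
theorem n_le_length_ctx : I.n ≤ (ctxOf I r k y Y).length := by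
  have h := n_le_length_encode I r
  rw [ctxOf, length_boolPair, zOf, length_stageInput]
  omega

/-- **Value of `foldC`**: the coded list of the `N` items. [folklore] -/
theorem foldC_ctx : foldC P pN (ctxOf I r k y Y) = encList (List.ofFn fun j : Fin (pN.eval I.n) => itemOf P I r k y Y j) := by
  have hK : pN.eval I.n ≤ pN.eval (ctxOf I r k y Y).length := TM2Iter.eval_mono pN (n_le_length_ctx I r k y Y)
  rw [foldC, Function.comp_apply, Function.comp_apply, loopRec_apply, bNC_ctx, foldLoop_apply _ _ hK,
    sndPow_succ_boolPair, sndPow_succ_boolPair, sndPow_zero_boolPair, foldAcc_clipF, foldAcc_appF, List.nil_append,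
    ← frames_eq_encList, frames_ofFn_eq_ccat']
  · refine ccat_congr fun i hi => ?_
    rw [zero_add, pieceP_pc, dif_pos hi]
  · intro i _ hi
    rw [zero_add] at hi
    rw [pieceP_pc, length_boolPair, List.length_nil]
    have h1 := length_itemOf_le P I r k y Y i
    have h2 : Y.length ≤ (ctxOf I r k y Y).length := by rw [ctxOf, length_boolPair]; omega
    omega

/-- Value of `padC`: the padding. [folklore] -/
@[simp] theorem padC_ctx : padC mS (ctxOf I r k y Y) = ones (mS.eval (GapSVPInstance.encode (I, r)).length) := by
  rw [padC, Function.comp_apply, xC_ctx, polyFn_apply]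

/-- **Value of the collecting post-processor**: the batch code of the `N` items, then the padding.
[cite: Regev2009, Theorem 3.1 (proof, p. 15)] -/
theorem postG_ctx : postG P pN mS (boolPair (stageInput (GapSVPInstance.encode (I, r)) k y) Y) =
    encList (List.ofFn fun j : Fin (pN.eval I.n) => itemOf P I r k y Y j) ++
      ones (mS.eval (GapSVPInstance.encode (I, r)).length) := by
  rw [← show ctxOf I r k y Y = boolPair (stageInput (GapSVPInstance.encode (I, r)) k y) Y from rfl, postG,
    Function.comp_apply, fanoutFn_apply, appF_boolPair, foldC_ctx, padC_ctx]

/-- **The collected string is a batch code** when every item is a vector code. [folklore] -/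
theorem postG_ctx_of_items {v : Fin (pN.eval I.n) → Fin I.n → ℤ}
    (hv : ∀ j : Fin (pN.eval I.n), itemOf P I r k y Y j = vecCode I.n (v j)) :
    postG P pN mS (boolPair (stageInput (GapSVPInstance.encode (I, r)) k y) Y) =
      encBatch I.n (pN.eval I.n) v ++ ones (mS.eval (GapSVPInstance.encode (I, r)).length) := by
  rw [postG_ctx, encBatch]
  congr 2
  exact List.ofFn_inj.2 (_root_.funext hv)

end Values

end StagePost

end Regev2009

end Literature.Computability.Cryptography

end
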